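/-
Origin: expansion seat `planner-pub-hodgecm-mc-axioms-1-g14-0`, handover #W53 2026-08-20T15:53:55Z md5 0ab215d75165 (PKG 2a5d485ced86 → 0ab215d75165; 169 l.; MECHANICAL (iib-R) rewrite v3.1 of the PKG file as it stands (35 token edits; rules R1x1+RX[h₂']x34)) (`HOME/mc/pub-hodgecm-mc-axioms-1-g14/revendor/kit-r55/stage55/HodgeCM/Model/ThetaSpaceInputPinRigidity.lean`, md5 0ab215d75165, 169 lines);
landed by the gen-22 packager (p-g22) in gate run 55 REPLACES the earlier landed copy of `HodgeCM/Model/ThetaSpaceInputPinRigidity.lean` (seat copy carried the packager Origin header of an earlier run (stripped)).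
-/
/-
Copyright (c) 2026. Released under Apache 2.0 license as described in the file LICENSE.
Cell pub-hodgecm, MODEL layer (construction prover mc-theta-3, gen 3), node T3-classPacks / E binders `X`, `C`:
rigidity of the archimedean `K`-type socket OVER THE PIN.
-/
import Summits.HodgeConjecture.HodgeCM.Model.ArchKTypeRigidity
import Summits.HodgeConjecture.HodgeCM.Model.ThetaSpaceInputPin_2

/-!
# Over the pinned theta-space input, E's binder `C` forces a non-trivial Weil action

`Model/ArchKTypeRigidity` proves, over an arbitrary theta-space input `X`, that archimedean `K`-type data
`C : ArchKTypeData X k N` (`N ≠ 0`) forces `(X.P k).ω (ι_∞ κ₁ u, 1) ≠ 1` for some `u ∈ K₁`, PROVIDED the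
classical weight `τ₁` has no non-zero invariant vector.  Here that proviso is DISCHARGED for the pin
`X := Model.thetaSpaceInputOf … S V c` of `Model/ThetaSpaceInputPin` (both branches): there
`K₁ = Stab_{U(2,1)}(x₀)` and `τ₁ = weightOf x₀` is the isotropy representation of the cotangent cocycle
`(k, z) ↦ (Jac k z)ᵀ` on `ℂ² = T^*_{x₀}𝔹²`, and the tree's `BallModel.irred` (vendored twin
`Vendored/H21/Geometry/ComplexHyperbolic/UnitBallIsotropy`: no line of `T^*_x𝔹²` is stable under `Stab(x)`)
leaves no invariant vector (`weightOf_x₀_eq_zero_of_forall_eq`).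

Consequences (all theorems, kernel, citing nothing): for every adelic side `S`, type index `k`, level `N ≠ 0`,
any `C : ArchKTypeData (thetaSpaceInputOf … S V c) k N` moves some `φ_N(Φ_∞ ℓ)` by some
`(S V c).ιinf u`, `u ∈ Stab(x₀)` (`exists_omega_apply_ne_in` / `_pin`), so `((S V c).P k).ω ≠ 1`
(`omega_ne_one_in`); and NO such `C` exists when `((S V c).P k).ω = 1` (`isEmpty_archKTypeData_in` / `_off` /
`_pin`).  This is
the kernel form of the sanity profile of revision R9 of the `E` term (`Model/E2InstanceR9`): the sub-binder `S`
(Weil pair data) is free DATA and can be chosen degenerately, but then the binder `C` is uninhabited — the honest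
archimedean Weil representation cannot be bypassed.

No `structure`/`def … : Prop` packaging, no cited fact; PerL / QW8 / the 2001 programme are not used.
-/

noncomputable section

open MulAction
open Literature.Geometry.ComplexHyperbolic.BallModel (U21 Ball x₀ Jac irred wedge)
open Literature.NumberTheory.Automorphic Literature.NumberTheory.Automorphic.AutomorphyFactor
open Literature.AlgebraicGeometry.HodgeTheory
open Literature.AlgebraicGeometry.ShimuraVarieties
open Literature.NumberTheory.Automorphic.PicardCM
open HodgeCM.Model.SupplyResidual

namespace HodgeCM
namespace Model

/-! ### § 1. The isotropy representation `weightOf x₀` has no invariant vector -/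

/-- **No cotangent vector at `x₀` is fixed by the whole stabiliser** (from `BallModel.irred`: no stable line). -/
theorem weightOf_x₀_eq_zero_of_forall_eq (w : Fin 2 → ℂ)
    (h : ∀ u : stabilizer U21 x₀, BallForms.isPullbackCocycle_cotangentCocycle.weightOf x₀ u w = w) :
    w = 0 := by
  by_contra hw
  obtain ⟨k, hk, hwedge⟩ := irred x₀ w hw
  have hmem : k⁻¹ ∈ stabilizer U21 x₀ := by
    rw [mem_stabilizer_iff, inv_smul_eq_iff, hk]
  have h1 := h ⟨k⁻¹, hmem⟩
  rw [IsPullbackCocycle.weightOf_apply, Subgroup.coe_mk, inv_inv, BallForms.cotangentCocycle_apply] at h1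
  apply hwedge
  rw [h1, wedge]
  ring

/-! ### § 2. The pin: both branches carry `K₁ = Stab(x₀)`, `τ₁ = weightOf x₀` -/

section Pin

variable (hHD : exists_isReal_hodgeModel) (hI : hodgePQ_independent_of_hodgeModel)
  (h₁ : BallQuotientUniformised)  (h₃ : CMAbelianVarietyRealised)

variable {L : CMField} {ι₁ : L →+* ℂ} {V : HermSpace3 L ι₁} {c : SeesawCtx L}

/-- (Ported verbatim from the HodgeCMPerL package; no docstring in the source.) -/
theorem thetaSpaceInputIn_tau_rigid (Sv : ThetaAdelicSide V c) (hV : IsAnisotropic L V.Hm)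
    (w : (thetaSpaceInputIn hHD hI h₁ h₃ Sv hV).W)
    (h : ∀ u : (thetaSpaceInputIn hHD hI h₁ h₃ Sv hV).K₁, (thetaSpaceInputIn hHD hI h₁ h₃ Sv hV).τ₁ u w = w) :
    w = 0 :=
  weightOf_x₀_eq_zero_of_forall_eq w h

/-- (Ported verbatim from the HodgeCMPerL package; no docstring in the source.) -/
theorem thetaSpaceInputOff_tau_rigid (Sv : ThetaAdelicSide V c)
    (w : (thetaSpaceInputOff hHD hI h₁ h₃ Sv).W)
    (h : ∀ u : (thetaSpaceInputOff hHD hI h₁ h₃ Sv).K₁, (thetaSpaceInputOff hHD hI h₁ h₃ Sv).τ₁ u w = w) :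
    w = 0 :=
  weightOf_x₀_eq_zero_of_forall_eq w h

variable (S : ∀ {L : CMField} {ι₁ : L →+* ℂ} (V : HermSpace3 L ι₁) (c : SeesawCtx L), ThetaAdelicSide V c)

/-- Transport of `τ₁`-rigidity along an equality of inputs (the pin is a `dite`). -/
theorem ThetaSpaceInput.tau_rigid_of_eq {U : Universe} {X Y : ThetaSpaceInput U V c} (e : X = Y)
    (hY : ∀ w : Y.W, (∀ u : Y.K₁, Y.τ₁ u w = w) → w = 0) :
    ∀ w : X.W, (∀ u : X.K₁, X.τ₁ u w = w) → w = 0 := by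
  subst e
  exact hY

/-- `τ₁` of the pin `X := thetaSpaceInputOf … S V c` has no non-zero invariant vector (either branch). -/
theorem thetaSpaceInputOf_tau_rigid (V : HermSpace3 L ι₁) (c : SeesawCtx L) :
    ∀ w : (thetaSpaceInputOf hHD hI h₁ h₃ S V c).W,
      (∀ u : (thetaSpaceInputOf hHD hI h₁ h₃ S V c).K₁, (thetaSpaceInputOf hHD hI h₁ h₃ S V c).τ₁ u w = w) →
        w = 0 := by
  by_cases hV : IsAnisotropic L V.Hm
  · exact ThetaSpaceInput.tau_rigid_of_eq (thetaSpaceInputOf_of_isAnisotropic hHD hI h₁ h₃ S V c hV)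
      (thetaSpaceInputIn_tau_rigid hHD hI h₁ h₃ (S V c) hV)
  · exact ThetaSpaceInput.tau_rigid_of_eq (thetaSpaceInputOf_of_not_isAnisotropic hHD hI h₁ h₃ S V c hV)
      (thetaSpaceInputOff_tau_rigid hHD hI h₁ h₃ (S V c))

/-! ### § 3. Rigidity of `C` over the pin -/

variable {V : HermSpace3 L ι₁} {c : SeesawCtx L} {k : Fin 4} {N : ℕ}

/-- **Over the regime branch (the type of E's binder `C` in `Model/E2InstanceR9`), `C` moves the family:**
some `u ∈ Stab(x₀)` and `ℓ` with `ω (ι_∞ u, 1) φ_N(Φ_∞ ℓ) ≠ φ_N(Φ_∞ ℓ)`. -/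
theorem exists_omega_apply_ne_in {Sv : ThetaAdelicSide V c} {hV : IsAnisotropic L V.Hm}
    (C : ArchKTypeData (thetaSpaceInputIn hHD hI h₁ h₃ Sv hV) k N) (hN : N ≠ 0) :
    ∃ (u : stabilizer U21 x₀) (ℓ : Module.Dual ℂ (Fin 2 → ℂ)),
      (Sv.P k).ω (Sv.ιinf u, 1) (C.Φfam ℓ) ≠ C.Φfam ℓ :=
  C.exists_omega_apply_ne hN (thetaSpaceInputIn_tau_rigid hHD hI h₁ h₃ Sv hV)

/-- **Over the regime branch, the Weil action of the adelic side is not trivial** once `C` is inhabited at one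
level `N ≠ 0`. -/
theorem omega_ne_one_in {Sv : ThetaAdelicSide V c} {hV : IsAnisotropic L V.Hm}
    (C : ArchKTypeData (thetaSpaceInputIn hHD hI h₁ h₃ Sv hV) k N) (hN : N ≠ 0) : (Sv.P k).ω ≠ 1 := by
  obtain ⟨u, hu⟩ := C.omega_ne_one hN (thetaSpaceInputIn_tau_rigid hHD hI h₁ h₃ Sv hV)
  intro h
  exact hu (by rw [thetaSpaceInputIn_P, h]; rfl)

/-- **No archimedean `K`-type data over the regime branch with a trivial Weil action** (`N ≠ 0`): E's binder
`C` of `Model/E2InstanceR9` is uninhabited over such an `S`. -/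
theorem isEmpty_archKTypeData_in (Sv : ThetaAdelicSide V c) (hV : IsAnisotropic L V.Hm) (hω : (Sv.P k).ω = 1)
    (hN : N ≠ 0) : IsEmpty (ArchKTypeData (thetaSpaceInputIn hHD hI h₁ h₃ Sv hV) k N) :=
  ⟨fun C => omega_ne_one_in hHD hI h₁ h₃ C hN hω⟩

/-- The same over the off-regime branch. -/
theorem isEmpty_archKTypeData_off (Sv : ThetaAdelicSide V c) (hω : (Sv.P k).ω = 1) (hN : N ≠ 0) :
    IsEmpty (ArchKTypeData (thetaSpaceInputOff hHD hI h₁ h₃ Sv) k N) :=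
  ⟨fun C => by
    obtain ⟨u, hu⟩ := C.omega_ne_one hN (thetaSpaceInputOff_tau_rigid hHD hI h₁ h₃ Sv)
    exact hu (by rw [show (thetaSpaceInputOff hHD hI h₁ h₃ Sv).P = Sv.P from rfl, hω]; rfl)⟩

/-- **Over the pin `X := thetaSpaceInputOf … S V c` itself:** `C` moves the family (statement over the pin's
own fields). -/
theorem exists_omega_apply_ne_pin (C : ArchKTypeData (thetaSpaceInputOf hHD hI h₁ h₃ S V c) k N)
    (hN : N ≠ 0) :
    ∃ (u : (thetaSpaceInputOf hHD hI h₁ h₃ S V c).K₁)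
      (ℓ : Module.Dual ℂ (thetaSpaceInputOf hHD hI h₁ h₃ S V c).W),
      ((thetaSpaceInputOf hHD hI h₁ h₃ S V c).P k).ω
          ((thetaSpaceInputOf hHD hI h₁ h₃ S V c).ιinf C.Γ₀
            ((thetaSpaceInputOf hHD hI h₁ h₃ S V c).κ₁ u), 1) (C.Φfam ℓ) ≠ C.Φfam ℓ :=
  C.exists_omega_apply_ne hN (thetaSpaceInputOf_tau_rigid hHD hI h₁ h₃ S V c)

/-- Transport of emptiness of the socket along an equality of inputs. -/
theorem ArchKTypeData.isEmpty_of_eq {U : Universe} {X Y : ThetaSpaceInput U V c} (e : X = Y)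
    (h : IsEmpty (ArchKTypeData Y k N)) : IsEmpty (ArchKTypeData X k N) := by
  subst e
  exact h

/-- **No archimedean `K`-type data over the pin with a trivial Weil action** (`N ≠ 0`, either branch). -/
theorem isEmpty_archKTypeData_pin (hω : ((S V c).P k).ω = 1) (hN : N ≠ 0) :
    IsEmpty (ArchKTypeData (thetaSpaceInputOf hHD hI h₁ h₃ S V c) k N) := by
  by_cases hV : IsAnisotropic L V.Hm
  · exact ArchKTypeData.isEmpty_of_eq (thetaSpaceInputOf_of_isAnisotropic hHD hI h₁ h₃ S V c hV)
      (isEmpty_archKTypeData_in hHD hI h₁ h₃ (S V c) hV hω hN)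
  · exact ArchKTypeData.isEmpty_of_eq (thetaSpaceInputOf_of_not_isAnisotropic hHD hI h₁ h₃ S V c hV)
      (isEmpty_archKTypeData_off hHD hI h₁ h₃ (S V c) hω hN)

end Pin

end Model
end HodgeCM
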